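import Summits.CriticalPhenomena.CardyFormulaZ2.Theses.CardyMagicRigidity
import Literature.Probability.Percolation.CardyFormulaConformalInvariance
import Literature.Probability.Percolation.BoxCrossingUpperBound
import Literature.Probability.Percolation.ZdNearCriticalWindow
import Literature.Probability.Percolation.HalfSpacePinnedPairs
import Literature.Probability.Percolation.SharpnessDCTProofs
import Literature.Probability.RandomPlanarGeometry.ConformalRectangleProofs
import Literature.Probability.Percolation.TriCrossingSandwich
import Literature.Probability.Percolation.DualCrosscutBlocking

/-!
# Stub B of line `oracle-sandwich`: a dual-open lattice path across `arc 1`, `arc 3` blocks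
every open G02 crossing from `arc 0` to `arc 2`

Crux `Summit.CriticalPhenomena.CardyFormulaZ2.Theses.CardyMagicRigidity.LoopsToCrossings`
(stmt-CriticalPhenomena-4837), line `oracle-sandwich`, stub `stub_not_discreteCrossing_of_dualPathIn`
(the bond/dual port of the upper half of the Bollobás–Riordan sandwich, *Percolation* (2006),
Ch. 7, Claims 19–20 p. 192 and the remark p. 195; the `𝕋` twin is
`Literature.Probability.Percolation.not_mem_triCrossing_compl_of_pathIn`).

Given a path of the graph `openGraph (dualConfig ω) ⊓ ℤ²` (dual vertices joined by dual-open
edges), read at the planar dual positions `dualScale δ x = δ x + δ (½, ½)`, whose off-`Ω` sites are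
`t`-close to `arc 1 ∪ arc 3`, whose in-`Ω` sites are `3δ`-off `arc 0 ∪ arc 2` and `ρ`-off the
corners, from an off-`Ω` site near `arc 1` to one near `arc 3`, we extract (run extraction
`PathIn.exists_run` with the strict inside graph and the outside steps near `arc 1` / `arc 3`)
its run strictly inside `Ω` between the last step near `arc 1` and the first later step near
`arc 3`, complete it by the two first-exit pieces of the adjacent planar dual edges (they end on
`arc 1°`, `arc 3°`), and obtain a cross-cut `Λ` of `Ω` made of pieces of dual-open planar dual
edges, every point of which is within `δ` of the dual position of an in-`Ω` site of the path,
hence farther than `2δ` from `arc 0 ∪ arc 2`.  The blocking step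
(`Literature.Probability.Percolation.not_mem_discreteCrossing_of_far_crosscut`,
`DualCrosscutBlocking.lean`, a variant of `not_mem_discreteCrossing_of_crosscut` in which the
"near `b'` / near `d'` / deep" trichotomy is replaced by the margin `> 2δ` to `arc 0 ∪ arc 2`;
the planar-point step classification `segment_subset_or_exists_near`,
`exists_exit_of_exists_near`, `false_of_infDist_le_of_infDist_le` is there too):
an open `Ω_δ`-path from the discrete arc of `arc 0` to that of `arc 2`, extended by its two
frontier exits (each within `2δ` of its arc), is a connected subset of `Ω̄` joining the two
boundary arcs cut off by `Λ`, hence meets `Λ` (Newman's cross-cut theorem,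
`Newman1939_crosscut_holds`); on the lattice part this contradicts
`disjoint_walkTrace_image_edgeTrace` (an open primal edge does not cross a dual-open dual edge),
and on the exit pieces the margin.
-/

noncomputable section

namespace Summit.CriticalPhenomena.CardyFormulaZ2.Cruxes.LoopsToCrossings.OracleSandwich

open Summit.CriticalPhenomena.CardyFormulaZ2.Theses.CardyMagicRigidity
open Literature.Probability.RandomPlanarGeometry hiding cardyFunction
open Literature.Probability.Percolation hiding cardyFunction
open Literature.Probability.LatticeModels
open Literature.Topology.PlaneTopology
open Filter Topology Set MeasureTheory Metric

/-! ## The stub -/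

/-- **Stub B — bond/dual port of the upper half of the Bollobás–Riordan sandwich**
(deterministic, EVERY Jordan conformal rectangle, corner margin `ρ`; `𝕋` twin
`not_mem_triCrossing_compl_of_pathIn`). For `0 < δ < δ₀(R, ρ)`, `0 ≤ t ≤ t₀(R)`: a dual-open
path (pairs of dual vertices in `dualConfig ω`, i.e. crossing CLOSED primal edges), read at the
physical dual positions `dualScale δ x = δx + δ(½,½)`, whose off-`Ω` sites are `t`-close to
`arc 1 ∪ arc 3`, whose in-`Ω` sites are `3δ`-off `arc 0 ∪ arc 2` and `ρ`-off the corners, from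
an off-`Ω` site near `arc 1` to one near `arc 3`, excludes every open G02 crossing of `Ω_δ`
from `arc 0` to `arc 2`: its strictly-inside run extended by the two exit pieces is a cross-cut
of dual-open planar dual edges from `arc 1°` to `arc 3°`, farther than `2δ` from
`arc 0 ∪ arc 2`, which an open crossing extended to the frontier would have to meet
(`not_mem_discreteCrossing_of_far_crosscut`).
[cite: BollobasRiordan2006, Ch. 7 Claims 19–20 p. 192 and remark p. 195] -/
theorem stub_not_discreteCrossing_of_dualPathIn :
    ∀ (R : ConformalRectangle) (ρ : ℝ), 0 < ρ →
      ∃ δ₀ > 0, ∃ t₀ > 0, ∀ δ t : ℝ, 0 < δ → δ < δ₀ → 0 ≤ t → t ≤ t₀ →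
        ∀ (ω : BondConfig (Site 2)) (S : Set (Site 2)) (u v : Site 2),
          (∀ x ∈ S, dualScale δ (Site.toComplex x) ∉ R.carrier →
            infDist (dualScale δ (Site.toComplex x)) (R.arc 1) ≤ t ∨
              infDist (dualScale δ (Site.toComplex x)) (R.arc 3) ≤ t) →
          (∀ x ∈ S, dualScale δ (Site.toComplex x) ∈ R.carrier →
            3 * δ < infDist (dualScale δ (Site.toComplex x)) (R.arc 0) ∧
              3 * δ < infDist (dualScale δ (Site.toComplex x)) (R.arc 2)) →
          (∀ x ∈ S, dualScale δ (Site.toComplex x) ∈ R.carrier →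
            ∀ j : Fin 4, ρ ≤ dist (dualScale δ (Site.toComplex x)) (R.pt j)) →
          dualScale δ (Site.toComplex u) ∉ R.carrier →
            infDist (dualScale δ (Site.toComplex u)) (R.arc 1) ≤ t →
          dualScale δ (Site.toComplex v) ∉ R.carrier →
            infDist (dualScale δ (Site.toComplex v)) (R.arc 3) ≤ t →
          PathIn (openGraph (dualConfig ω) ⊓ zdGraph 2) S u v →
          ω ∉ discreteCrossing R.carrier δ (R.arc 0) (R.arc 2) := by
  intro R ρ hρ
  classical
  obtain ⟨ε, hε, hεd⟩ := R.exists_pos_forall_lt_dist_arc_one_three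
  obtain ⟨ε', hε', hε'd⟩ := R.exists_pos_forall_lt_dist_arc
  obtain ⟨h0, h01, h12, h23, h3⟩ := mark_chain R
  -- continuity modulus of the boundary loop at scale `ρ / 2`
  obtain ⟨η, hη, -, hηc⟩ := exists_forall_dist_boundary_lt R (half_pos hρ)
  -- the far boundary pieces keep a positive distance from `arc 0`, `arc 2`
  obtain ⟨ε₀, hε₀, hfar₀⟩ := exists_pos_forall_lt_infDist
    (isCompact_Icc.image R.continuous_boundary) (R.isClosed_arc 0)
    (disjoint_image_Icc_arc_zero R hη) ⟨_, R.pt_mem_arc_self 0⟩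
  obtain ⟨ε₂, hε₂, hfar₂⟩ := exists_pos_forall_lt_infDist
    (isCompact_Icc.image R.continuous_boundary) (R.isClosed_arc 2)
    (disjoint_image_Icc_arc_two R hη) ⟨_, R.pt_mem_arc_self 2⟩
  refine ⟨min (min (ε / 8) (ε' / 2)) (min (min (ε₀ / 3) (ε₂ / 3)) (ρ / 2)), by positivity,
    ε / 8, by positivity, ?_⟩
  intro δ t hδ hδlt ht htle ω S u v hout hin hcorner huΩ huA hvΩ hvB hP
  have hδε : δ < ε / 8 := hδlt.trans_le ((min_le_left _ _).trans (min_le_left _ _))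
  have hδε' : δ < ε' / 2 := hδlt.trans_le ((min_le_left _ _).trans (min_le_right _ _))
  have hδε₀ : δ < ε₀ / 3 :=
    hδlt.trans_le ((min_le_right _ _).trans ((min_le_left _ _).trans (min_le_left _ _)))
  have hδε₂ : δ < ε₂ / 3 :=
    hδlt.trans_le ((min_le_right _ _).trans ((min_le_left _ _).trans (min_le_right _ _)))
  have hδρ : δ < ρ / 2 := hδlt.trans_le ((min_le_right _ _).trans (min_le_right _ _))
  set Ω := R.carrier with hΩ
  set A := R.arc 1 with hA
  set B := R.arc 3 with hB
  have hΩo : IsOpen Ω := R.isOpen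
  have hδabs : |δ| = δ := abs_of_pos hδ
  have hfr : frontier Ω ⊆ (A ∪ B) ∪ (R.arc 0 ∪ R.arc 2) := frontier_subset_arcs_one_three R
  have hfr' : frontier Ω ⊆ (B ∪ A) ∪ (R.arc 0 ∪ R.arc 2) := hfr.trans (by rw [union_comm A B])
  have hAne : A.Nonempty := ⟨_, R.pt_mem_arc_self 1⟩
  have hBne : B.Nonempty := ⟨_, R.pt_mem_arc_self 3⟩
  have hAB : ∀ p ∈ A, ∀ q ∈ B, 2 * t + 2 * δ < dist p q := fun p hp q hq => by
    linarith [hεd p hp q hq]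
  have hBA : ∀ p ∈ B, ∀ q ∈ A, 2 * t + 2 * δ < dist p q := fun p hp q hq => by
    rw [dist_comm]; exact hAB q hq p hp
  have hin' : ∀ x ∈ S, dualScale δ (Site.toComplex x) ∈ Ω →
      δ < infDist (dualScale δ (Site.toComplex x)) (R.arc 0) ∧
        δ < infDist (dualScale δ (Site.toComplex x)) (R.arc 2) := fun x hx hxΩ =>
    ⟨by linarith [(hin x hx hxΩ).1], by linarith [(hin x hx hxΩ).2]⟩
  -- planar dual edges have length `≤ δ`
  have hlen : ∀ {x y : Site 2}, (zdGraph 2).Adj x y →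
      dist (dualScale δ (Site.toComplex x)) (dualScale δ (Site.toComplex y)) ≤ δ := by
    intro x y hxy
    rw [dist_comm]
    exact dist_le_of_mem_image_dualScale_edgeTrace hδ.le hxy
      (mem_image_of_mem _ (toComplex_mem_edgeTrace_right _ _))
  have hPxy : ∀ {x y : Site 2}, (zdGraph 2).Adj x y →
      dualScale δ (Site.toComplex x) ≠ dualScale δ (Site.toComplex y) := fun hxy h =>
    hxy.ne (funext fun k => by
      simpa using congrArg (fun z => coordVec z k) (dualScale_injective hδ.ne' h))
  -- the path graph, its strict inside subgraph, and the outside steps near `A`, `B`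
  set G : SimpleGraph (Site 2) := openGraph (dualConfig ω) ⊓ zdGraph 2 with hG
  have hGo : ∀ {x y : Site 2}, G.Adj x y → s(x, y) ∈ dualConfig ω := fun h =>
    ((openGraph_adj _ _ _).1 h.1).1
  obtain ⟨H, hHadj⟩ : ∃ H : SimpleGraph (Site 2), ∀ x y, H.Adj x y ↔ G.Adj x y ∧
      segment ℝ (dualScale δ (Site.toComplex x)) (dualScale δ (Site.toComplex y)) ⊆ Ω :=
    ⟨{ Adj := fun x y => G.Adj x y ∧
          segment ℝ (dualScale δ (Site.toComplex x)) (dualScale δ (Site.toComplex y)) ⊆ Ω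
       symm := ⟨fun x y h => ⟨h.1.symm, by rw [segment_symm]; exact h.2⟩⟩
       loopless := ⟨fun x h => h.1.ne rfl⟩ }, fun _ _ => Iff.rfl⟩
  have hHG : H ≤ G := fun x y h => ((hHadj x y).1 h).1
  have hHz : H ≤ zdGraph 2 := fun x y h => ((hHadj x y).1 h).1.2
  have hHΩl : ∀ {p q : Site 2}, H.Adj p q → dualScale δ (Site.toComplex p) ∈ Ω := fun h =>
    ((hHadj _ _).1 h).2 (left_mem_segment ℝ _ _)
  have hHΩr : ∀ {p q : Site 2}, H.Adj p q → dualScale δ (Site.toComplex q) ∈ Ω := fun h =>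
    ((hHadj _ _).1 h).2 (right_mem_segment ℝ _ _)
  obtain ⟨LA, hLA⟩ : ∃ LA : Site 2 → Site 2 → Prop, ∀ x y, LA x y ↔
      ∃ z ∈ segment ℝ (dualScale δ (Site.toComplex x)) (dualScale δ (Site.toComplex y)),
        z ∉ Ω ∧ infDist z A ≤ t := ⟨_, fun _ _ => Iff.rfl⟩
  obtain ⟨LB, hLB⟩ : ∃ LB : Site 2 → Site 2 → Prop, ∀ x y, LB x y ↔
      ∃ z ∈ segment ℝ (dualScale δ (Site.toComplex x)) (dualScale δ (Site.toComplex y)),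
        z ∉ Ω ∧ infDist z B ≤ t := ⟨_, fun _ _ => Iff.rfl⟩
  have hclass : ∀ a ∈ S, ∀ b ∈ S, G.Adj a b → H.Adj a b ∨ LA a b ∨ LB a b := by
    intro a haS b _ hab
    rcases segment_subset_or_exists_near hΩo hfr ht (hlen hab.2) (hout a haS) (hin' a haS) with
      h | h | h
    · exact Or.inl ((hHadj a b).2 ⟨hab, h⟩)
    · exact Or.inr (Or.inl ((hLA a b).2 h))
    · exact Or.inr (Or.inr ((hLB a b).2 h))
  have hu' : ∀ b ∈ S, G.Adj u b → ¬ H.Adj u b ∧ LA u b := fun b _ _ =>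
    ⟨fun h => huΩ (hHΩl h), (hLA u b).2 ⟨_, left_mem_segment ℝ _ _, huΩ, huA⟩⟩
  have hv' : ∀ a ∈ S, G.Adj a v → ¬ H.Adj a v ∧ ¬ LA a v := fun a _ hav =>
    ⟨fun h => hvΩ (hHΩr h), fun h => by
      obtain ⟨z, hz, -, hzA⟩ := (hLA a v).1 h
      exact false_of_infDist_le_of_infDist_le hδ hAne hBne hAB
        ((dist_le_dist_of_mem_segment hz (right_mem_segment ℝ _ _)).trans (hlen hav.2)) hzA hvB⟩
  have huv : u ≠ v := by
    rintro rfl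
    exact false_of_infDist_le_of_infDist_le hδ hAne hBne hAB (by rw [dist_self]; exact hδ.le)
      huA hvB
  obtain ⟨a', a, b, b', ha'S, ha'a, -, hL0, hrun, hb'S, hbb', -, hnL0, hL2⟩ :=
    PathIn.exists_run (H := H) hHG hclass hu' hv' huv hP
  obtain ⟨za, hza, hzaΩ, hzaA⟩ := (hLA a' a).1 hL0
  obtain ⟨zb, hzb, hzbΩ, hzbB⟩ := (hLB b b').1 hL2
  have haS : a ∈ S := hrun.left_mem
  have hbS : b ∈ S := hrun.right_mem
  have haa' : (zdGraph 2).Adj a a' := ha'a.2.symm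
  have hbb'z : (zdGraph 2).Adj b b' := hbb'.2
  set Pa := dualScale δ (Site.toComplex a) with hPa
  set Pb := dualScale δ (Site.toComplex b) with hPb
  set Pa' := dualScale δ (Site.toComplex a') with hPa'
  set Pb' := dualScale δ (Site.toComplex b') with hPb'
  have hzaPa : dist za Pa ≤ δ :=
    (dist_le_dist_of_mem_segment hza (right_mem_segment ℝ _ _)).trans (hlen ha'a.2)
  -- the ends of the run are inside `Ω`
  have haΩ : Pa ∈ Ω := by
    by_contra h
    rcases hout a haS h with h' | h'
    · by_cases hab : a = b
      · subst hab
        exact hnL0 ((hLA a b').2 ⟨_, left_mem_segment ℝ _ _, h, h'⟩)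
      · obtain ⟨c, -, hac⟩ := hrun.exists_adj_head hab
        exact h (hHΩl hac)
    · exact false_of_infDist_le_of_infDist_le hδ hAne hBne hAB hzaPa hzaA h'
  have hbΩ : Pb ∈ Ω := by
    by_contra h
    rcases hout b hbS h with h' | h'
    · exact hnL0 ((hLA b b').2 ⟨_, left_mem_segment ℝ _ _, h, h'⟩)
    · by_cases hab : a = b
      · subst hab
        exact false_of_infDist_le_of_infDist_le hδ hAne hBne hAB hzaPa hzaA h'
      · obtain ⟨c, -, hcb⟩ := hrun.exists_adj_last hab
        exact h (hHΩr hcb)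
  -- the exits at the two ends: points of `arc 1°`, `arc 3°`
  obtain ⟨sa, fa, hsa0, hsa1, hfa, hfafr, hfaΩ, hfaA, hafa, hbeforea⟩ :=
    exists_exit_of_exists_near hΩo hfr hAne hδ hAB (hlen haa') (by rwa [segment_symm] at hza)
      hzaΩ hzaA haΩ (hin' a haS haΩ)
  obtain ⟨sb, fb, hsb0, hsb1, hfb, hfbfr, hfbΩ, hfbB, hbfb, hbeforeb⟩ :=
    exists_exit_of_exists_near hΩo hfr' hBne hδ hBA (hlen hbb'z) hzb hzbΩ hzbB hbΩ
      (hin' b hbS hbΩ)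
  have hoff : ∀ {p : Site 2} {f : ℂ} (j : Fin 4), p ∈ S →
      dualScale δ (Site.toComplex p) ∈ Ω → dist (dualScale δ (Site.toComplex p)) f ≤ δ →
      (j = 0 ∨ j = 2) → f ∉ R.arc j := by
    intro p f j hpS hpΩ hpf hj hf
    have h1 := infDist_le_dist_of_mem (x := dualScale δ (Site.toComplex p)) hf
    rcases hj with rfl | rfl
    · linarith [(hin p hpS hpΩ).1]
    · linarith [(hin p hpS hpΩ).2]
  obtain ⟨ss, hss, hfass⟩ := exists_mem_Ioo_of_mem_arc_one R hfaA
    (hoff 0 haS haΩ hafa (Or.inl rfl)) (hoff 2 haS haΩ hafa (Or.inr rfl))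
  obtain ⟨tt, htt, hfbtt⟩ := exists_mem_Ioo_of_mem_arc_three R hfbB
    (hoff 2 hbS hbΩ hbfb (Or.inr rfl)) (hoff 0 hbS hbΩ hbfb (Or.inl rfl))
  have hst : ss < tt := by linarith [hss.2, htt.1]
  have hts : tt < ss + 1 := by linarith [hss.1, htt.2]
  -- the end-points are far from the corners, hence parameter-far from the marks
  have hfar_pt : ∀ {p : Site 2} {f : ℂ} (j : Fin 4), p ∈ S →
      dualScale δ (Site.toComplex p) ∈ Ω → dist (dualScale δ (Site.toComplex p)) f ≤ δ →
      ρ / 2 ≤ dist f (R.pt j) := by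
    intro p f j hpS hpΩ hpf
    have := hcorner p hpS hpΩ j
    linarith [dist_triangle (dualScale δ (Site.toComplex p)) f (R.pt j)]
  obtain ⟨hs', hs'', ht', ht''⟩ := param_bounds_of_dist_pt R hηc hss htt
    (hfass ▸ hfar_pt 1 haS haΩ hafa) (hfass ▸ hfar_pt 2 haS haΩ hafa)
    (hfbtt ▸ hfar_pt 3 hbS hbΩ hbfb) (hfbtt ▸ hfar_pt 0 hbS hbΩ hbfb)
  have H0 : ∀ f ∈ frontier Ω, infDist f (R.arc 0) ≤ 2 * δ →
      ∃ w ∈ Ioo tt (ss + 1), f = R.boundary w := fun f hf hfd =>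
    exists_Ioo_of_infDist_arc_zero R (fun p hp => by linarith [hfar₀ p hp]) hs' ht'' hf hfd
  have H2 : ∀ f ∈ frontier Ω, infDist f (R.arc 2) ≤ 2 * δ →
      ∃ w ∈ Ioo ss tt, f = R.boundary w := fun f hf hfd =>
    exists_Ioo_of_infDist_arc_two R (fun p hp => by linarith [hfar₂ p hp]) hs' hs'' ht' hf hfd
  have hdisj : discreteArc Ω δ (R.arc 0) ∩ discreteArc Ω δ (R.arc 2) = ∅ :=
    discreteArc_inter_eq_empty_of_lt R hε'd (by rw [hδabs]; linarith)
  -- the strict run as a lattice path whose planar dual edges are dual-open and lie in `Ω`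
  obtain ⟨W, hW⟩ := hrun.exists_walk
  set π : (zdGraph 2).Walk a b := W.bypass.mapLe hHz with hπ
  have hπs : ∀ z ∈ π.support, z ∈ S := fun z hz => by
    rw [hπ, SimpleGraph.Walk.support_mapLe_eq_support] at hz
    exact hW z (W.support_bypass_subset_support hz)
  have hπH : ∀ p q : Site 2, s(p, q) ∈ π.edges → H.Adj p q := fun p q he => by
    rw [hπ, SimpleGraph.Walk.edges_mapLe_eq_edges] at he
    exact W.adj_of_mem_edges (W.edges_bypass_subset_edges he)
  have hπΩ : ∀ e ∈ π.edges, dualScale δ '' edgeTrace e ⊆ Ω := by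
    intro e he
    induction e using Sym2.ind with
    | h p q => rw [image_dualScale_edgeTrace]; exact ((hHadj p q).1 (hπH p q he)).2
  have hπo : ∀ e ∈ π.edges, e ∈ dualConfig ω := by
    intro e he
    induction e using Sym2.ind with
    | h p q => exact hGo ((hHadj p q).1 (hπH p q he)).1
  have hπpath : π.IsPath := (SimpleGraph.Walk.isPath_mapLe hHz).2 W.bypass_isPath
  -- `Pa ≠ Pb`: near `arc 1` and `arc 3` respectively
  have hfafb : ε < dist fa fb := hεd fa hfaA fb hfbB
  have hPab : Pa ≠ Pb := by
    intro h
    have h1 : dist Pb fa ≤ δ := h ▸ hafa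
    linarith [dist_triangle fa Pb fb, dist_comm fa Pb]
  have hπn : ¬ π.Nil := fun hn => hPab (by rw [hPa, hPb, hn.eq])
  -- the three arcs and their gluing
  have hTarc : IsSimpleArc (dualScale δ '' walkTrace π) Pa Pb :=
    (isSimpleArc_walkTrace hπpath hπn).image (continuous_dualScale δ) (dualScale_injective hδ.ne')
  have hAarc : IsSimpleArc (segment ℝ Pa fa) fa Pa := by
    have := IsSimpleArc.subsegment (hPxy haa') hsa0
    rw [← hfa] at this
    exact this.symm
  have hBarc : IsSimpleArc (segment ℝ Pb fb) Pb fb := by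
    have := IsSimpleArc.subsegment (hPxy hbb'z) hsb0
    rw [← hfb] at this
    exact this
  have h₁ : segment ℝ Pa fa ∩ dualScale δ '' walkTrace π ⊆ {Pa} :=
    segment_inter_image_walkTrace_subset hδ haa' hsa0 hsa1 hfa hfaΩ hπΩ
  have h₂ : (segment ℝ Pa fa ∪ dualScale δ '' walkTrace π) ∩ segment ℝ Pb fb ⊆ {Pb} := by
    rintro z ⟨hz | hz, hz'⟩
    · -- the two exit pieces are far apart
      exfalso
      have h1 : dist z Pa ≤ δ := dist_le_of_mem_exit_segment hδ.le haa' hsa0.le hsa1 hfa hz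
      have h2 : dist z Pb ≤ δ := dist_le_of_mem_exit_segment hδ.le hbb'z hsb0.le hsb1 hfb hz'
      linarith [dist_triangle4 fa Pa z Pb, dist_triangle fa Pb fb, dist_comm fa Pa,
        dist_comm Pa z]
    · have := segment_inter_image_walkTrace_subset hδ hbb'z hsb0 hsb1 hfb hfbΩ (Q := π.reverse)
        (fun e he => hπΩ e (by rwa [SimpleGraph.Walk.edges_reverse, List.mem_reverse] at he))
      refine this ⟨hz', ?_⟩
      rwa [show walkTrace π.reverse = walkTrace π by
        ext; simp only [mem_walkTrace_iff, SimpleGraph.Walk.edges_reverse, List.mem_reverse]]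
  have harc : IsSimpleArc ((segment ℝ Pa fa ∪ dualScale δ '' walkTrace π) ∪ segment ℝ Pb fb)
      fa fb :=
    (hAarc.union hTarc h₁).union hBarc h₂
  set Λ : Set ℂ := (segment ℝ Pa fa ∪ dualScale δ '' walkTrace π) ∪ segment ℝ Pb fb with hΛ
  have hcross : R.IsCrosscut Λ (R.boundary ss) (R.boundary tt) := by
    refine ⟨?_, ?_, ?_, ?_, ?_⟩
    · rw [← hfass, ← hfbtt]; exact harc
    · rw [← hfass]; exact hfafr
    · rw [← hfbtt]; exact hfbfr
    · rw [← hfass, ← hfbtt]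
      intro h
      rw [h, dist_self] at hfafb
      linarith
    · rw [← hfass, ← hfbtt]
      rintro z ⟨((hz | hz) | hz), hzne⟩
      · exact mem_of_mem_subsegment_of_ne hsa0 hfa hbeforea hz (fun h => hzne (Or.inl h))
      · obtain ⟨z₀, hz₀, rfl⟩ := hz
        obtain ⟨e, he, hze⟩ := mem_walkTrace_iff.1 hz₀
        exact hπΩ e he (mem_image_of_mem _ hze)
      · exact mem_of_mem_subsegment_of_ne hsb0 hfb hbeforeb hz (fun h => hzne (Or.inr h))
  -- every point of `Λ` is on a dual-open planar dual edge, within `δ` of an in-`Ω` site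
  have hedge : ∀ z ∈ Λ, ∃ e ∈ dualConfig ω, z ∈ dualScale δ '' edgeTrace e := by
    rintro z ((hz | hz) | hz)
    · refine ⟨_, hGo ha'a.symm, ?_⟩
      rw [image_dualScale_edgeTrace]
      rw [hfa] at hz
      exact subsegment_subset hsa0.le hsa1 hz
    · obtain ⟨z₀, hz₀, rfl⟩ := hz
      obtain ⟨e, he, hze⟩ := mem_walkTrace_iff.1 hz₀
      exact ⟨e, hπo e he, mem_image_of_mem _ hze⟩
    · refine ⟨_, hGo hbb', ?_⟩
      rw [image_dualScale_edgeTrace]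
      rw [hfb] at hz
      exact subsegment_subset hsb0.le hsb1 hz
  have hnear : ∀ z ∈ Λ, ∃ p ∈ S, dualScale δ (Site.toComplex p) ∈ Ω ∧
      dist z (dualScale δ (Site.toComplex p)) ≤ δ := by
    rintro z ((hz | hz) | hz)
    · exact ⟨a, haS, haΩ, dist_le_of_mem_exit_segment hδ.le haa' hsa0.le hsa1 hfa hz⟩
    · obtain ⟨z₀, hz₀, rfl⟩ := hz
      obtain ⟨e, he, hze⟩ := mem_walkTrace_iff.1 hz₀
      revert he hze
      induction e using Sym2.ind with
      | h p q =>
        intro he hze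
        have hpq := (hHadj p q).1 (hπH p q he)
        exact ⟨p, hπs p (π.fst_mem_support_of_mem_edges he), hpq.2 (left_mem_segment ℝ _ _),
          dist_le_of_mem_image_dualScale_edgeTrace hδ.le hpq.1.2 (mem_image_of_mem _ hze)⟩
    · exact ⟨b, hbS, hbΩ, dist_le_of_mem_exit_segment hδ.le hbb'z hsb0.le hsb1 hfb hz⟩
  have hfarΛ : ∀ z ∈ Λ, 2 * δ < infDist z (R.arc 0) ∧ 2 * δ < infDist z (R.arc 2) := by
    intro z hz
    obtain ⟨p, hpS, hpΩ, hzp⟩ := hnear z hz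
    obtain ⟨h0', h2'⟩ := hin p hpS hpΩ
    have k0 := infDist_le_infDist_add_dist (s := R.arc 0) (x := dualScale δ (Site.toComplex p))
      (y := z)
    have k2 := infDist_le_infDist_add_dist (s := R.arc 2) (x := dualScale δ (Site.toComplex p))
      (y := z)
    rw [dist_comm] at hzp
    constructor <;> linarith
  exact not_mem_discreteCrossing_of_far_crosscut R hst hts hcross hδ hedge hfarΛ H0 H2 hdisj

end Summit.CriticalPhenomena.CardyFormulaZ2.Cruxes.LoopsToCrossings.OracleSandwich
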